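import Mathlib
import HarnessLib
import Summits.Parity.BatemanHorn.Theses.AlmostPrimeZeros
import Summits.Parity.BatemanHorn.Theorems.AlmostPrimeZerosSystemMomentDeficitVerticalLine

/-!
# Crux `SystemMomentDeficit` (stmt-Parity-11326): the crux IS the vertical sub-Gaussian germ —
# `SystemMomentDeficit ↔ (∀ x ∃ y₀)`, while the line's stub VSG is `(∃ y₀ ∀ x)`

Route `AlmostPrimeZeros`, crux
`Summit.Parity.BatemanHorn.Theses.AlmostPrimeZeros.SystemMomentDeficit` (rank 4), line `Sketch`,
lead c6.  Sorry-free, definition-free.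

Lead c6 reshaped the line's registered stub to VSG = `stub_verticalSubGaussian`: for every
Bateman–Horn system there are `C`, `y₀ > 0`, `x₀` with `‖S_x(1+iy)‖ ≤ (x+1)e^{Cy²}` for ALL
`x ≥ x₀` and `0 < y ≤ y₀` (`S_x(z) = Σ_{n ≤ x} z^{s_f(n)}`), and landed VSG ⇒ crux
(`systemMomentDeficit_of_verticalSubGaussian`, p163855) and K1 ⇒ VSG (p164463).  This file
calibrates the reshape exactly:

* `verticalGerm_of_deficit_le` — **converse per statistic**: if `m₁ − v ≤ C` at `x`, then for some
  `y₀ = y₀(x) > 0`, `‖S_x(1+iy)‖ ≤ (x+1)·exp((C/2 + 1/4)y²)` for `0 < y ≤ y₀` (the identity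
  `(d²/dy²)‖S_x(1+iy)‖²|₀ = 2(x+1)²(m₁ − v)` of `…VerticalLine.lean`, the definition of the
  derivative of `y ↦ (d/dy)‖S_x(1+iy)‖²` at `0` with tolerance `(x+1)²`, one mean-value step, and
  `1 + t ≤ e^t`).
* `systemMomentDeficit_iff_verticalGerm` (registered sub-goal) — **the crux is EQUIVALENT to the
  vertical sub-Gaussian bound with an `x`-dependent window**:
  `SystemMomentDeficit ↔ ∀ BH f ∃ C ∀ x ≥ 2 ∃ y₀ > 0 ∀ y ∈ (0, y₀], ‖S_x(1+iy)‖ ≤ (x+1)e^{Cy²}`.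

So the crux (`∀ x ∃ y₀`) and the line's open stub VSG (`∃ y₀ ∀ x ≥ x₀`) differ by exactly one
quantifier swap: the entire open content of the line beyond the crux itself is the UNIFORMITY of the
window `y₀` in `x` — Gaussian decay of the size-tilted characteristic function `E_x(1+iy)^{s_f}` at a
fixed (not shrinking) frequency.  Fixed-scale hypotheses that reach the germ without quantifying over
`y → 0` must be two-dimensional (harmonicity): K1 `stub_smallCircleJensen`, rank 8 `DiscMajorantLog`.
-/

noncomputable section

namespace Summit.Parity.BatemanHorn.Cruxes.SystemMomentDeficit.SmallCircle

open scoped BigOperators Nat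
open Complex Filter Set Topology

/-- **Converse per statistic: a deficit bound gives the vertical sub-Gaussian germ.**  If
`m₁ − v ≤ C` for `S(z) = Σ_{n ≤ x} z^{e n}`, then `‖S(1+iy)‖ ≤ (x+1)·exp((C/2 + 1/4)·y²)` for all
`0 < y ≤ y₀`, for some `y₀ > 0` depending on `e`, `x`. -/
theorem verticalGerm_of_deficit_le (e : ℕ → ℕ) (x : ℕ) (C : ℝ)
    (hC : ((∑ n ∈ Finset.range (x + 1), e n : ℕ) : ℝ) / ((x : ℝ) + 1) -
      ((((∑ n ∈ Finset.range (x + 1), (e n) ^ 2 : ℕ)) : ℝ) / ((x : ℝ) + 1) -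
        (((∑ n ∈ Finset.range (x + 1), e n : ℕ) : ℝ) / ((x : ℝ) + 1)) ^ 2) ≤ C) :
    ∃ y₀ : ℝ, 0 < y₀ ∧ ∀ y : ℝ, 0 < y → y ≤ y₀ →
      ‖∑ n ∈ Finset.range (x + 1), (1 + (y : ℂ) * I) ^ (e n)‖ ≤
        ((x : ℝ) + 1) * Real.exp ((C / 2 + 1 / 4) * y ^ 2) := by
  set N : ℝ := (x : ℝ) + 1 with hN
  have hNpos : 0 < N := by rw [hN]; positivity
  set Se : ℝ := ((∑ n ∈ Finset.range (x + 1), e n : ℕ) : ℝ) with hSe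
  set Se2 : ℝ := ((∑ n ∈ Finset.range (x + 1), (e n) ^ 2 : ℕ) : ℝ) with hSe2
  -- q y = ‖S(1+iy)‖², q' = Re E₁, q''(0) = L := 2 (Se² − N (Se2 − Se)) = 2 N² (m₁ − v)
  set q : ℝ → ℝ := fun y : ℝ => ‖∑ n ∈ Finset.range (x + 1), (1 + (y : ℂ) * I) ^ (e n)‖ ^ 2 with hq
  set q' : ℝ → ℝ := fun y : ℝ =>
      ((∑ n ∈ Finset.range (x + 1), (e n : ℂ) * (1 + (y : ℂ) * I) ^ (e n - 1) * I) *
          (∑ n ∈ Finset.range (x + 1), (1 + (y : ℂ) * (-I)) ^ (e n)) +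
        (∑ n ∈ Finset.range (x + 1), (1 + (y : ℂ) * I) ^ (e n)) *
          (∑ n ∈ Finset.range (x + 1), (e n : ℂ) * (1 + (y : ℂ) * (-I)) ^ (e n - 1) * (-I))).re
    with hq'
  set L : ℝ := 2 * (Se ^ 2 - N * (Se2 - Se)) with hL
  have hqd : ∀ y, HasDerivAt q (q' y) y := fun y => hasDerivAt_normSq_vertical e x y
  have hq'0 : q' 0 = 0 := deriv_normSq_vertical_zero e x
  have hq'd : HasDerivAt q' L 0 := by
    have h := hasDerivAt_deriv_normSq_vertical_zero e x
    rw [← hSe, ← hSe2, ← hN] at h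
    exact h
  -- tolerance N²: |q' t − L t| ≤ N² |t| for |t| < δ
  have hsmall : ∀ᶠ t in 𝓝 (0 : ℝ), ‖q' t - q' 0 - (t - 0) • L‖ ≤ N ^ 2 * ‖t - 0‖ := by
    have hN2 : 0 < N ^ 2 := by positivity
    have h := hq'd.isLittleO
    rw [Asymptotics.isLittleO_iff] at h
    exact h hN2
  rw [Metric.eventually_nhds_iff] at hsmall
  obtain ⟨δ, hδ, hδ'⟩ := hsmall
  refine ⟨δ / 2, by positivity, ?_⟩
  intro y hy hyδ
  have hyδ' : y < δ := by linarith
  -- φ t := q t − (L + N²) t²/2 is non-increasing on [0, y]: φ' t = q' t − (L + N²) t ≤ 0 for 0 ≤ t < δ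
  have hφd : ∀ t, HasDerivAt (fun t => q t - (L + N ^ 2) * t ^ 2 / 2) (q' t - (L + N ^ 2) * t) t := by
    intro t
    have h2 : HasDerivAt (fun t : ℝ => (L + N ^ 2) * t ^ 2 / 2) ((L + N ^ 2) * t) t := by
      have := (((hasDerivAt_id t).fun_pow 2).const_mul (L + N ^ 2)).div_const 2
      refine this.congr_deriv ?_
      simp; ring
    exact (hqd t).sub h2
  have hφ'le : ∀ t, 0 ≤ t → t < δ → q' t - (L + N ^ 2) * t ≤ 0 := by
    intro t ht htδ
    have hmem : dist t 0 < δ := by simpa [Real.dist_eq, abs_of_nonneg ht] using htδ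
    have h := hδ' hmem
    rw [hq'0, sub_zero, sub_zero, smul_eq_mul, Real.norm_eq_abs, Real.norm_eq_abs,
      abs_of_nonneg ht] at h
    have h' : q' t - t * L ≤ N ^ 2 * t := (le_abs_self _).trans h
    nlinarith
  have hcont : ContinuousOn (fun t => q t - (L + N ^ 2) * t ^ 2 / 2) (Icc 0 y) :=
    fun t _ => (hφd t).continuousAt.continuousWithinAt
  obtain ⟨c, hc, hceq⟩ := exists_hasDerivAt_eq_slope (fun t => q t - (L + N ^ 2) * t ^ 2 / 2)
    (fun t => q' t - (L + N ^ 2) * t) hy hcont (fun t _ => hφd t)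
  have hcle : q' c - (L + N ^ 2) * c ≤ 0 := hφ'le c hc.1.le (lt_trans hc.2 hyδ')
  rw [hceq] at hcle
  have hq0 : q 0 = N ^ 2 := by
    simp only [hq, Complex.ofReal_zero, zero_mul, add_zero, one_pow, Finset.sum_const,
      Finset.card_range, nsmul_eq_mul, mul_one]
    rw [show ((x + 1 : ℕ) : ℂ) = ((N : ℝ) : ℂ) by rw [hN]; push_cast; rfl, Complex.norm_real,
      Real.norm_eq_abs, abs_of_pos hNpos]
  have hqy : q y ≤ N ^ 2 + (L + N ^ 2) * y ^ 2 / 2 := by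
    have hnum : (q y - (L + N ^ 2) * y ^ 2 / 2 - (q 0 - (L + N ^ 2) * 0 ^ 2 / 2)) / (y - 0) ≤ 0 := hcle
    rw [div_nonpos_iff] at hnum
    rcases hnum with ⟨h1, _⟩ | ⟨h1, h2⟩
    · rw [hq0] at h1; nlinarith
    · linarith
  -- L = 2 N² (m₁ − v) ≤ 2 N² C
  have hLC : L ≤ 2 * N ^ 2 * C := by
    have hdef : Se / N - (Se2 / N - (Se / N) ^ 2) = (Se ^ 2 - N * (Se2 - Se)) / N ^ 2 := by
      field_simp
      ring
    have hC' : (Se ^ 2 - N * (Se2 - Se)) / N ^ 2 ≤ C := by rw [← hdef]; exact hC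
    rw [div_le_iff₀ (by positivity)] at hC'
    rw [hL]; nlinarith
  -- q y ≤ N² (1 + (C + 1/2) y²) ≤ N² exp((C + 1/2) y²)
  have hqy' : q y ≤ N ^ 2 * Real.exp ((C + 1 / 2) * y ^ 2) := by
    have h1 : q y ≤ N ^ 2 * (1 + (C + 1 / 2) * y ^ 2) := by nlinarith [sq_nonneg y, sq_nonneg N]
    have h2 : 1 + (C + 1 / 2) * y ^ 2 ≤ Real.exp ((C + 1 / 2) * y ^ 2) := by
      linarith [Real.add_one_le_exp ((C + 1 / 2) * y ^ 2)]
    exact h1.trans (mul_le_mul_of_nonneg_left h2 (by positivity))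
  -- take square roots
  have hsq : (N * Real.exp ((C / 2 + 1 / 4) * y ^ 2)) ^ 2 = N ^ 2 * Real.exp ((C + 1 / 2) * y ^ 2) := by
    rw [mul_pow, ← Real.exp_nat_mul]; ring_nf
  have hnn : 0 ≤ ‖∑ n ∈ Finset.range (x + 1), (1 + (y : ℂ) * I) ^ (e n)‖ := norm_nonneg _
  have hpos : 0 ≤ N * Real.exp ((C / 2 + 1 / 4) * y ^ 2) := by positivity
  have hq_y : q y = ‖∑ n ∈ Finset.range (x + 1), (1 + (y : ℂ) * I) ^ (e n)‖ ^ 2 := rfl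
  rw [hq_y, ← hsq] at hqy'
  exact (pow_le_pow_iff_left₀ hnn hpos two_ne_zero).1 hqy'

/-- **The crux is the vertical sub-Gaussian germ** (registered sub-goal of the line `Sketch`):
`SystemMomentDeficit` holds iff for every Bateman–Horn system there is `C` such that for every `x ≥ 2`
SOME window `y₀ = y₀(x) > 0` has `‖Σ_{n≤x}(1+iy)^{s_f(n)}‖ ≤ (x+1)e^{Cy²}` for `0 < y ≤ y₀`.  The
line's open stub VSG `stub_verticalSubGaussian` is the same statement with the window uniform in `x`. -/
theorem systemMomentDeficit_iff_verticalGerm : Summit.Parity.BatemanHorn.Theses.AlmostPrimeZeros.SystemMomentDeficit ↔ ∀ (k : ℕ) (f : Fin k → Polynomial ℤ), Literature.NumberTheory.Sieve.IsBatemanHornSystem f → ∃ C : ℝ, ∀ x : ℕ, 2 ≤ x → ∃ y₀ : ℝ, 0 < y₀ ∧ ∀ y : ℝ, 0 < y → y ≤ y₀ → ‖∑ n ∈ Finset.range (x + 1), (1 + (y : ℂ) * Complex.I) ^ (∑ i, (((f i).eval (n : ℤ)).toNat.factorization.sum fun _ v => min v 2))‖ ≤ ((x : ℝ) + 1) * Real.exp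 (C * y ^ 2) := by
  unfold Summit.Parity.BatemanHorn.Theses.AlmostPrimeZeros.SystemMomentDeficit
  constructor
  · intro h k f hf
    obtain ⟨C, hC⟩ := h k f hf
    refine ⟨C / 2 + 1 / 4, fun x hx => ?_⟩
    exact verticalGerm_of_deficit_le
      (fun n => ∑ i, (((f i).eval (n : ℤ)).toNat.factorization.sum fun _ v => min v 2)) x C (hC x hx)
  · intro h k f hf
    obtain ⟨C, hC⟩ := h k f hf
    refine ⟨2 * C, fun x hx => ?_⟩
    obtain ⟨y₀, hy₀, hb⟩ := hC x hx
    exact deficit_le_of_verticalBound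
      (fun n => ∑ i, (((f i).eval (n : ℤ)).toNat.factorization.sum fun _ v => min v 2)) x C y₀ hy₀ hb

end Summit.Parity.BatemanHorn.Cruxes.SystemMomentDeficit.SmallCircle

end
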